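/-
Copyright (c) 2026. H413 campaign `hodgecm-mathlib`, squad K2, seat K2E1-p11 (gen 0).  Lane: `--supports stmt-HodgeConjecture-24833 --as helper` (count-neutral).
Deal (13′)∕(26) of the dealer K2E1-plan (g6), ED. 2: `hK1_cm_two` WITHOUT the cuspidality binder — K2-defs1's every-rank head ★ p859335 plugged in.
-/
import Summits.HodgeConjecture.HodgeConjecture.Theorems.K2E1TruncatedCuspDecayHK1CMTwo            -- ★ (this seat, p859321): `hK1_cm_two_of`
import Summits.HodgeConjecture.HodgeConjecture.Theorems.K2E1TruncatedCuspConstantTermAEU2       -- ★ (K2-defs1 g6, p859335): `ae_borelConstantTerm_indicator_comp_eq_zero_of_mem_HNcusp`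
import Summits.HodgeConjecture.HodgeConjecture.Theorems.K2E1IntertwinedSectionInvariance        -- ★ `map_conj_toAdelic_eq_self_two` (AVG's `hconj` at the CM pair, `N = 2`)
import HarnessLib

/-!
# K1-L² for `U(1,1)`: `hK1_cm_two` — the closer's `hK1` letter for `h = η ∗ η`, conditional ONLY on the measure letters of record and the comparison clause

sorry-free · THEOREMS ONLY · lane `--supports stmt-HodgeConjecture-24833 --as helper`.

★ `hK1_cm_two_of` (this seat) with its cuspidality binder `hcuspN` DISCHARGED by K2-defs1's every-rank ★ `ae_borelConstantTerm_indicator_comp_eq_zero_of_mem_HNcusp` (whose one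
structural letter `hconj` is ★ `map_conj_toAdelic_eq_self_two` at the CM pair).  `N(𝔸)` carries the subtype σ-algebra of `G(𝔸)`'s (as in K2-defs1's head).  What the closer supplies: `ν_G` Haar, inversion- and right-invariant; the unfolding pair `(hβ, hμZ)` of
record; the test function `η₀` (`IsTestFunctionGL 2 L η₀`); the levels `c₁`, `c₀ > 0` with the comparison clause `hΩ` and its constant `κ`, `κ·c₁ ≤ c₀` (★ `exists_heckePackage′`);
the decay order `m ≥ 0`.  Output: **`∃ C ≥ 0, ∀ f ∈ 𝓗_k^cusp(Z_{c₁}), ‖R(η ∗ η) f (z)‖ ≤ C·‖f‖·HZ(z)^{−m}` a.e. for `HZ^{−2k}μZ|_{Z_{c₀}}`** — the `hK1` of ★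
`K2E1TruncatedCuspCompactU2.isCompactOperator_deltaShift_comp_subtypeL_HNcusp_of_cusp_decay` (every `m`, so in particular some `m > 0`).
THE CHAIN (all ★): K1a∕b∕c `K2E1TruncatedZeroMean[AE]U2`, `…KernelDifferencesU2`, `…KernelDecayU2` → engine `…CuspDecayL2U2` → junction `…CuspDecayHNU2Transport` → wrapper
`…CuspDecayHNU2` → `hmass` `…CuspMassBoundU2[Compact]` (K2E4-p10 ∕ this seat) → growth `…CuspMassGrowthU2` → `…CuspDecayHNU2OfUnfolding` → bridge `…ConstantTermBridgeU2` + tile data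
→ band `…CuspBandBoundU2` (K2E1-p02) → `…CuspDecayHK1CMTwo` → (ii) `…ConstantTermAEU2` (K2-defs1) → this file.
[cite: BernsteinLapid2019, §4 Claims 4–5 (p. 10)] [cite: MoeglinWaldspurger1995, I.2.13]
-/

noncomputable section

set_option autoImplicit false

set_option linter.dupNamespace false

open NumberField IsDedekindDomain MeasureTheory Measure Set Function Filter Topology
open scoped NNReal MatrixGroups Pointwise ENNReal Classical

namespace Summit.HodgeConjecture.HodgeConjecture.Cruxes.H413.K2E1TruncatedCuspDecayHK1CMTwoFinal

open Literature.MeasureTheory.Group Literature.NumberTheory.Automorphic Literature.NumberTheory.Automorphic.UnitaryGroup AdelicGroupData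
open Summit.HodgeConjecture.HodgeConjecture.Cruxes.H413.K2E1BLBorelSpacesU2Defs
open Summit.HodgeConjecture.HodgeConjecture.Cruxes.H413.K2E1BLBorelOperatorsU2Defs (rightConvFun)
open Summit.HodgeConjecture.HodgeConjecture.Cruxes.H413.K2E1TruncatedCuspDecayHK1CMTwo (hK1_cm_two_of)
open Summit.HodgeConjecture.HodgeConjecture.Cruxes.H413.K2E1TruncatedCuspConstantTermAEU2 (ae_borelConstantTerm_indicator_comp_eq_zero_of_mem_HNcusp)
open Summit.HodgeConjecture.HodgeConjecture.Cruxes.H413.K2E1IntertwinedSectionInvariance (map_conj_toAdelic_eq_self_two)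

variable (L : Type) [Field L] [NumberField L] [IsCMField L]

/-- **`hK1_cm_two` — THE CLOSER'S `hK1` LETTER FOR `h = η ∗ η` (cusp decay of `R(η ∗ η)` on `𝓗_k^cusp(Z_{c₁})`, a.e. for `HZ^{−2k}μZ|_{Z_{c₀}}`), conditional only on the
measure letters of record `(hβ, hμZ)`, the Haar hypotheses on `ν_G`, and the comparison clause `hΩ` (`κ·c₁ ≤ c₀`).**  ★ `hK1_cm_two_of` ∘ ★ K2-defs1's
`ae_borelConstantTerm_indicator_comp_eq_zero_of_mem_HNcusp` ∘ ★ `map_conj_toAdelic_eq_self_two`. [cite: BernsteinLapid2019, §4 Claims 4–5 (p. 10)] [cite: MoeglinWaldspurger1995, I.2.13] -/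
theorem hK1_cm_two [MeasurableSpace (quasiSplit (↥(maximalRealSubfield L)) L (IsCMField.complexConj L) 2).Adelic] [BorelSpace (quasiSplit (↥(maximalRealSubfield L)) L (IsCMField.complexConj L) 2).Adelic]
    (μZ : Measure (borelQuotient (↥(maximalRealSubfield L)) L (IsCMField.complexConj L) 2)) (νG : Measure (quasiSplit (↥(maximalRealSubfield L)) L (IsCMField.complexConj L) 2).Adelic) [νG.IsHaarMeasure] [νG.IsInvInvariant] [νG.IsMulRightInvariant]
    [MeasurableSpace (AdeleRing (𝓞 L) L)] [BorelSpace (AdeleRing (𝓞 L) L)]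
    {β : (quasiSplit (↥(maximalRealSubfield L)) L (IsCMField.complexConj L) 2).Adelic → ℝ≥0∞} (hβ : IsCoveringWeight ↥((arithmeticBorel (↥(maximalRealSubfield L)) L (IsCMField.complexConj L) 2).map (quasiSplit (↥(maximalRealSubfield L)) L (IsCMField.complexConj L) 2).arithmeticSubgroup.subtype) β)
    (hμZ : ∀ f : borelQuotient (↥(maximalRealSubfield L)) L (IsCMField.complexConj L) 2 → ℝ≥0∞, Measurable f → ∫⁻ z, f z ∂μZ = ∫⁻ g, β g * f (toBorelQuotient (↥(maximalRealSubfield L)) L (IsCMField.complexConj L) 2 g) ∂νG)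
    {η₀ : GL (Fin 2) (AdeleRing (𝓞 L) L) → ℝ} (hη₀ : IsTestFunctionGL 2 L η₀) (k : ℕ) (c₁ c₀ : ℝ≥0) (hc₀ : 0 < c₀)
    {κ : ℝ≥0} (hκ : 0 < κ) (hc : κ * c₁ ≤ c₀)
    (hΩ : ∀ z : borelQuotient (↥(maximalRealSubfield L)) L (IsCMField.complexConj L) 2, ∀ y ∈ tsupport (fun y => orbitalSmoothing νG (fun g : (quasiSplit (↥(maximalRealSubfield L)) L (IsCMField.complexConj L) 2).Adelic => ((η₀ (adelicVal (↥(maximalRealSubfield L)) L (IsCMField.complexConj L) 2 ((StdForm.antidiagonal 2).over L) g) : ℝ) : ℂ)) (fun g : (quasiSplit (↥(maximalRealSubfield L)) L (IsCMField.complexConj L) 2).Adelic => ((η₀ (adelicVal (↥(maximalRealSubfield L)) L (IsCMField.complexConj L) 2 ((StdForm.antidiagonal 2).over L) g) : ℝ) : ℂ)) y),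
      borelQuotHeight (↥(maximalRealSubfield L)) L (IsCMField.complexConj L) 2 z ≤ κ * borelQuotHeight (↥(maximalRealSubfield L)) L (IsCMField.complexConj L) 2 (rightShift (↥(maximalRealSubfield L)) L (IsCMField.complexConj L) 2 y z))
    {m : ℝ} (hm : 0 ≤ m) :
    ∃ C : ℝ, 0 ≤ C ∧ ∀ f : ↥(HNcusp (↥(maximalRealSubfield L)) L (IsCMField.complexConj L) 2 k c₁ μZ), ∀ᵐ z ∂(weightedTruncMeasure (↥(maximalRealSubfield L)) L (IsCMField.complexConj L) 2 k c₀ μZ),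
      ‖rightConvFun (↥(maximalRealSubfield L)) L (IsCMField.complexConj L) 2 νG (fun y => orbitalSmoothing νG (fun g : (quasiSplit (↥(maximalRealSubfield L)) L (IsCMField.complexConj L) 2).Adelic => ((η₀ (adelicVal (↥(maximalRealSubfield L)) L (IsCMField.complexConj L) 2 ((StdForm.antidiagonal 2).over L) g) : ℝ) : ℂ)) (fun g : (quasiSplit (↥(maximalRealSubfield L)) L (IsCMField.complexConj L) 2).Adelic => ((η₀ (adelicVal (↥(maximalRealSubfield L)) L (IsCMField.complexConj L) 2 ((StdForm.antidiagonal 2).over L) g) : ℝ) : ℂ)) y) ((f : HN (↥(maximalRealSubfield L)) L (IsCMField.complexConj L) 2 k c₁ μZ) : borelQuotient (↥(maximalRealSubfield L)) L (IsCMField.complexConj L) 2 → ℂ) z‖ ≤ C * ‖f‖ * ((borelQuotHeight (↥(maximalRealSubfield L)) L (IsCMField.complexConj L) 2 z : ℝ)) ^ (-m) := by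
  have hcc : IsCMField.complexConj L * IsCMField.complexConj L = 1 := AlgEquiv.ext fun x => IsCMField.complexConj_apply_apply L x
  exact hK1_cm_two_of L μZ νG hβ hμZ hη₀ k c₁ c₀ hc₀
    (fun νN _ _ _ 𝓕 h𝓕 h𝓕₀ h𝓕top f =>
      ae_borelConstantTerm_indicator_comp_eq_zero_of_mem_HNcusp νG νN
        (fun b₀ hb₀ => map_conj_toAdelic_eq_self_two hcc (IsCMField.complexConj_ne_one L) νN hb₀) h𝓕 h𝓕₀ h𝓕top hβ hμZ k c₁ f)
    hκ hc hΩ hm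

end Summit.HodgeConjecture.HodgeConjecture.Cruxes.H413.K2E1TruncatedCuspDecayHK1CMTwoFinal

end
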